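import Summits.HubbardSuperconductivity.HubbardSuperconductivity.Theses.FunctionFieldCertificate
import Summits.HubbardSuperconductivity.HubbardSuperconductivity.Theorems.FunctionFieldCertificateMesoscopicPairOrderSplit
import Summits.HubbardSuperconductivity.HubbardSuperconductivity.Theorems.FunctionFieldCertificateMesoscopicPairOrderSeedForms
import Summits.HubbardSuperconductivity.HubbardSuperconductivity.Theorems.FunctionFieldCertificateMesoscopicPairOrderProfilePosition
import Summits.HubbardSuperconductivity.HubbardSuperconductivity.Theorems.FunctionFieldCertificateMesoscopicPairOrderPointwiseGlue
import HarnessLib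

/-!
# Crux `MesoscopicPairOrder` (stmt-HubbardSuperconductivity-7331), line `redirect_birth` —
# the BC2-REDIRECT skeleton: the two pieces (A), (B) of the split, EACH cut into its own two stubs
# (planner cstrat-r1, 2026-08-17; RESHAPED by lead c9, 2026-08-17: (GS), (Flat) restricted to the box)

Route `FunctionFieldCertificate`, crux 2 (pole-free half): at one `(U, δ)` a margin `m R² ≤ T_R(ψ)/L²` for the
Fejér-box pair functional `T_R(ψ) = Σ_{x,y} Πᵢ (1 - |(y - x)ᵢ|_L/R)₊ Re⟨P_x ψ, P_y ψ⟩`,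
`P_x = localPair dWaveFormFactor L x`, at ARBITRARILY LARGE scales `R`, in every normalised `(N_L, S^z = 0)`-sector
ground state of `hubbardTorus 2 L 1 U` on all large even tori. The crux is open physics and is NOT settled here.

The route re-audit binned this crux RESTATED (tree theorem `mesoscopicPairOrder_iff_hubbardSuperconductivity`, which
holds GIVEN the pole half `WindowInfraredBound`; unconditionally the crux is NECESSARY for the summit, p90865). Under the
BC2 REDIRECT ruling (2026-08-16) it stands through its own typed decomposition
`MesoscopicPairOrder ⇐ GoldstonePairProfile (A) ∧ LeakBeatingBlockPairSeed (B)` — assembly = the LANDED glue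
`Theorems.FunctionFieldCertificate.mesoscopicPairOrderOfSubs` (p137259; pointwise one-scale closure, not a trivial
seam); pieces (A), (B) = the registered stubs of line `pointwise_split` (lead c6–c8), children.json ready for the
final-cycle `route edit --split … --glue-by …mesoscopicPairOrderOfSubs`. THIS line is the redirect's clause (d),
"a plan for both sides": each OPEN piece gets its own two-stub birth skeleton, and the four stubs compose to the crux.

RESHAPE (lead c9, wave 1): the two stub-worker audits of (GS) and (Flat) and the lead's glue
`meso_and_summit_of_boxStubs` (`Theorems/…PointwiseGlue.lean`, p151069) showed that the composition consumes
every stub at (D)'s witness point only, while (GS)/(Flat) were registered at ALL `U > 0`, `δ ∈ (0,1/2)` — so a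
pair-density wave or phase separation anywhere (e.g. the stripe regime `U ≳ 6`, or `U → ∞`) would kill a
registered stub without touching the crux. The reshaped stubs `stub_pairGoldstoneShapeOnBox`,
`stub_offWindowFlatOnBox` ask the same bodies on the box `U ∈ (0,6]`, `δ ∈ [1/10,3/10]` of (Q)/(D) only
(strictly WEAKER than before: every ∀(U,δ) engine of stmt-1089 still delivers them); (Q), (D) are unchanged;
the composition is now `meso_and_summit_of_boxStubs`, which also yields the SUMMIT (`HubbardSuperconductivity_of`).

Registered stubs (4):
* (GS)   `stub_pairGoldstoneShapeOnBox` — window Goldstone shape `S_ψ(m)·|q_m| ≤ A` on `0 < |q_m| ≤ ε₀`, every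
         sector GS, every `(U,δ)` OF THE BOX: the box restriction of the hypothesis of `wib_of_goldstoneShape` /
         of the output of the three landed stmt-1089 engines (moment method / C⁺_λ + charging floor /
         pair-yrast floor). OPEN (stub-blocked on `WindowInfraredBound.stub_pairGaussianDomination` +
         `stub_chargingFloor`, wave 1).
* (Flat) `stub_offWindowFlatOnBox` — flat law `S_ψ(m) ≤ S(η)` off every window `|q_m| > η`, every sector GS,
         every `(U,δ)` of the box: no PDW Bragg peak at a fixed nonzero momentum. OPEN (stub-blocked on zone-wide
         pair Gaussian domination + `stub_chargingFloor`, wave 1).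
         (GS) ∧ (Flat) ⇒ (A)-at-the-point is `profileAt_of_shapeAt_of_flatAt` (PointwiseGlue).
* (Q)    `stub_pairFluctuationFloor` — on the box `U ∈ (0,6]`, `δ ∈ [1/10,3/10]`, every FIXED scale `R ≥ 1` has a
         positive GS-uniform floor `c(U,δ,R) ≤ T_R(ψ)/L²` (normal-state pair fluctuations; no order). OPEN.
* (D)    `stub_coherenceDoubling` (LOAD-BEARING) — at SOME point of that box, `θ > 2`, `R₁` with
         `θ·T_R(ψ) ≤ T_{2R}(ψ)` for all `R ≥ R₁`, every sector GS: super-linear PROPAGATION of pair coherence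
         across dyadic scales (the U(1)-breaking content in scale-inductive form). OPEN, no engine.
         (Q) ∧ (D) ⇒ super-linear block pair order ⇒ (B) (`leakBeatingBlockPairSeedIffSuperlinear`, p137448).
Composition: `MesoscopicPairOrder_of := (meso_and_summit_of_boxStubs (GS) (Flat) (Q) (D)).1` — the crux BY NAME
(and `HubbardSuperconductivity_of := (…).2`, the summit); at (D)'s witness: (GS) ∧ (Flat) ⇒ profile,
(Q) ∧ (D) ⇒ super-linear block pair order ⇒ leak-beating seed ⇒ uniform sector pair order ⇒ crux ∧ summit
(all landed: DoublingCore p149577, DoublingPosition p150611, PointwiseGlue p151069); sorries only in the four stubs.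
Typed position of the cut (landed): given (A), crux ⟺ (Q)-body ∧ (D)-body at a common point
(`mesoscopicPairOrder_iff_floor_and_doubling`); UPO + profile ⇒ (D)-body for EVERY θ < 4
(`coherenceDoubling_of_uniformPairOrderAt_of_profileAt`).

Probes (planner folder `bc/`, attached as evidence; all with the landed library imported, `exact? | simpa | aesop`):
(A)→S, (A)→crux, (B)→S, (B)→crux, (A)∧Window→S/crux, (B)∧Window→S/crux: FAIL (12/12); crux→(B): succeeds
(necessity, by design); every `stub → piece`, `stub → crux`, `stub → S` (12 probes): FAIL.

Sources: Kennedy–Lieb–Shastry, PRL 61 (1988) 2582 [KLS1988PRL]; Dyson–Lieb–Simon, J. Stat. Phys. 18 (1978) 335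
[DysonLiebSimon1978]; Pitaevskii–Stringari, J. Low Temp. Phys. 85 (1991) 377 [PitaevskiiStringari1991];
Fröhlich–Simon–Spencer, CMP 50 (1976) 79; Fröhlich–Spencer, CMP 81 (1981) 527 (scale-by-scale propagation of
coherence, the shape of (D)); Stein–Shakarchi, *Fourier Analysis*, Ch. 2. No definition is introduced;
nothing here claims any stub, piece or the crux.
-/

noncomputable section

-- the summit namespace repeats the problem name by design (D-0017)
set_option linter.dupNamespace false

namespace Summit.HubbardSuperconductivity.HubbardSuperconductivity.Cruxes.MesoscopicPairOrder.RedirectBirth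

open Matrix Finset Filter
open Literature.Probability.LatticeModels Literature.MathematicalPhysics.QuantumLattice
open Summit.HubbardSuperconductivity.HubbardSuperconductivity.Theses.FunctionFieldCertificate
open Summit.HubbardSuperconductivity.HubbardSuperconductivity.Theorems.FunctionFieldCertificate
open scoped ComplexOrder ComplexConjugate

/-! ### Piece (A) `GoldstonePairProfile` — stubs (GS), (Flat) -/

/-- **Stub (GS) `stub_pairGoldstoneShapeOnBox`** (reshaped by lead c9: box-restricted) — WINDOW GOLDSTONE SHAPE
of the `d`-wave pair structure factor in every sector ground state: for all `U ∈ (0,6]`, `δ ∈ [1/10,3/10]` there are `A ≥ 0`, `ε₀ > 0`, `L₀` such that every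
normalised `(N_L,0)`-sector ground state `ψ` of `hubbardTorus 2 L 1 U`, `L ≥ L₀` even, has
`S_ψ(m) · |q_m| ≤ A` for every `m ≠ 0` with `|q_m| ≤ ε₀`. The box restriction of the hypothesis of
`wib_of_goldstoneShape` and of the output of the three landed stmt-1089 engines A/B/C, whose inputs
(torus pair stiffness; C⁺_λ pair Gaussian domination + charging floor `pairGap ≥ -κ/L`; exponent-one pair-yrast
floor) are the open physics. Why it might fail: one sector GS in the box with a `|Q| → 0`
pair-density wave, superconducting-puddle phase separation or a twisted condensate at `|q| = 2π/L` has
`S_ψ(q)|q| ≳ L` on the window; no reflection-positivity-free `T = 0` infrared bound is known for any quantum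
lattice model (Cruxes/WindowInfraredBound/STRATEGY-CENSUS.md §6). OPEN. -/
theorem stub_pairGoldstoneShapeOnBox :
    ∀ U : ℝ, U ∈ Set.Ioc (0:ℝ) 6 → ∀ δ : ℝ, δ ∈ Set.Icc (1 / 10 : ℝ) (3 / 10) →
      ∃ A ε₀ : ℝ, 0 ≤ A ∧ 0 < ε₀ ∧ ∃ L₀ : ℕ,
      ∀ (L : ℕ) [NeZero L], L₀ ≤ L → Even L →
        ∀ ψ : Fock (Orb (FermionTorus 2 L)), star ψ ⬝ᵥ ψ = 1 →
          IsGroundStateInSector (hubbardTorus 2 L 1 U) (2 * ⌊(1 - δ) * (L : ℝ) ^ 2 / 2⌋₊) 0 ψ →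
            ∀ m : TorusSite 2 L, m ≠ 0 → momentumNormSq L m ≤ ε₀ ^ 2 →
              pairStructureFactor dWaveFormFactor L ψ m * Real.sqrt (momentumNormSq L m) ≤ A := by
  sorry

/-- **Stub (Flat) `stub_offWindowFlatOnBox`** (reshaped by lead c9: box-restricted) — FLAT LAW OFF EVERY WINDOW:
for all `U ∈ (0,6]`, `δ ∈ [1/10,3/10]` and every `η > 0` there are `S ≥ 0`, `L₀` such that every normalised `(N_L,0)`-sector ground state `ψ` of
`hubbardTorus 2 L 1 U`, `L ≥ L₀` even, has `S_ψ(m) ≤ S` for every `m` with `|q_m| > η`: no pair-density-wave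
Bragg peak (`S_ψ(Q) ~ L²`) and no `L`-divergent pile-up at any FIXED nonzero momentum, in any sector ground
state. Why it might fail: PDW order at a fixed `Q ≠ 0` in some sector GS of the box (its edge `U = 6`,
`δ ≈ 1/8` touches the stripe regime: QinEtAl2020, XuEtAl2024 report PDW CORRELATIONS, decaying, in the pure model;
PDW long-range order in a Hubbard ground state is not established numerically or rigorously either way); a
priori only the Parseval total `Σ_m S_ψ(m) ≤ 32 L²` constrains a single mode. OPEN. -/
theorem stub_offWindowFlatOnBox :
    ∀ U : ℝ, U ∈ Set.Ioc (0:ℝ) 6 → ∀ δ : ℝ, δ ∈ Set.Icc (1 / 10 : ℝ) (3 / 10) →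
      ∀ η : ℝ, 0 < η → ∃ S : ℝ, 0 ≤ S ∧ ∃ L₀ : ℕ,
      ∀ (L : ℕ) [NeZero L], L₀ ≤ L → Even L →
        ∀ ψ : Fock (Orb (FermionTorus 2 L)), star ψ ⬝ᵥ ψ = 1 →
          IsGroundStateInSector (hubbardTorus 2 L 1 U) (2 * ⌊(1 - δ) * (L : ℝ) ^ 2 / 2⌋₊) 0 ψ →
            ∀ m : TorusSite 2 L, η ^ 2 < momentumNormSq L m →
              pairStructureFactor dWaveFormFactor L ψ m ≤ S := by
  sorry

/-! ### Piece (B) `LeakBeatingBlockPairSeed` — stubs (Q), (D) -/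

/-- **Stub (Q) `stub_pairFluctuationFloor`** — PAIR-FLUCTUATION FLOOR AT EVERY FIXED SCALE, on the box
`U ∈ (0,6]`, `δ ∈ [1/10, 3/10]`: for every block scale `R ≥ 1` there are `c > 0` and `L₀` such that every
normalised `(N_L,0)`-sector ground state `ψ` of `hubbardTorus 2 L 1 U` on every even torus `L ≥ L₀` has
`c ≤ T_R(ψ)/L²`. The floor may depend on `(U, δ, R)` in any way (a normal metal has `≈ 0.9 S(0)`, decaying
share `∼ S/R²` of the block area): this is positivity of the small-momentum `d`-wave pair fluctuations in every
ground state, NOT order. Why it might fail: a sector GS in the box whose pair structure factor vanishes near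
`q = 0` along `L → ∞` (partially polarised ferromagnet — only SATURATION is excluded on the box, p140748, and
`PolarisedCeiling` p143939 shows near-saturation drives `T_R` to `0`; phase separation; an `η`-paired corner
state). OPEN. -/
theorem stub_pairFluctuationFloor :
    ∀ U : ℝ, U ∈ Set.Ioc (0:ℝ) 6 → ∀ δ : ℝ, δ ∈ Set.Icc (1 / 10 : ℝ) (3 / 10) → ∀ R : ℕ, 0 < R →
      ∃ c : ℝ, 0 < c ∧ ∃ L₀ : ℕ, ∀ (L : ℕ) [NeZero L], L₀ ≤ L → Even L →
        ∀ ψ : Fock (Orb (FermionTorus 2 L)), star ψ ⬝ᵥ ψ = 1 →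
          IsGroundStateInSector (hubbardTorus 2 L 1 U) (2 * ⌊(1 - δ) * (L : ℝ) ^ 2 / 2⌋₊) 0 ψ →
            c ≤ (∑ x : TorusSite 2 L, ∑ y : TorusSite 2 L,
              (∏ i : Fin 2, max 0 (1 - |(((y i - x i).valMinAbs : ℤ) : ℝ)| / (R : ℝ))) *
                (star (localPair dWaveFormFactor L x *ᵥ ψ) ⬝ᵥ (localPair dWaveFormFactor L y *ᵥ ψ)).re) /
              (L : ℝ) ^ 2 := by
  sorry

/-- **Stub (D) `stub_coherenceDoubling`** (LOAD-BEARING) — SCALE-DOUBLING PROPAGATION OF PAIR COHERENCE at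
SOME point of the box `U ∈ (0,6]`, `δ ∈ [1/10, 3/10]`: there are `θ > 2` and `R₁` such that for every block
scale `R ≥ R₁`, eventually in even `L`, every normalised `(N_L,0)`-sector ground state has
`θ · T_R(ψ) ≤ T_{2R}(ψ)`. (`θ ≤ 4` is forced by `T_{2R} ≤ 4 T_R`, `boxSum_mul_le_sq_mul_boxSum` p140875;
`θ > 2` means the block pair order per unit LENGTH strictly grows along the dyadic scales, i.e. pair
(quasi-)order with exponent `η = 2 - log₂ θ < 1`.) Why it might fail: it is false at every point without
pair (quasi-)order (normal metal: `T_{2R}/T_R → 1`), and at an ordered point it needs `R₁ ≳ √(S/2a) ≈ 30–100`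
(flat background `S ≈ 2.2`, condensate `a ≈ 10⁻³`) — a uniform-in-GS inter-scale inequality for exact
doped-Hubbard ground states, for which no multiscale engine exists (no RP, constructive RG stops above the BCS
scale). OPEN, no engine; it is the statement a block-spin / scale-induction argument would prove. -/
theorem stub_coherenceDoubling :
    ∃ U : ℝ, U ∈ Set.Ioc (0:ℝ) 6 ∧ ∃ δ : ℝ, δ ∈ Set.Icc (1 / 10 : ℝ) (3 / 10) ∧ ∃ θ : ℝ, 2 < θ ∧ ∃ R₁ : ℕ,
      ∀ R : ℕ, R₁ ≤ R → ∃ L₀ : ℕ, ∀ (L : ℕ) [NeZero L], L₀ ≤ L → Even L →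
        ∀ ψ : Fock (Orb (FermionTorus 2 L)), star ψ ⬝ᵥ ψ = 1 →
          IsGroundStateInSector (hubbardTorus 2 L 1 U) (2 * ⌊(1 - δ) * (L : ℝ) ^ 2 / 2⌋₊) 0 ψ →
            θ * (∑ x : TorusSite 2 L, ∑ y : TorusSite 2 L,
              (∏ i : Fin 2, max 0 (1 - |(((y i - x i).valMinAbs : ℤ) : ℝ)| / (R : ℝ))) *
                (star (localPair dWaveFormFactor L x *ᵥ ψ) ⬝ᵥ (localPair dWaveFormFactor L y *ᵥ ψ)).re) ≤
            (∑ x : TorusSite 2 L, ∑ y : TorusSite 2 L,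
              (∏ i : Fin 2, max 0 (1 - |(((y i - x i).valMinAbs : ℤ) : ℝ)| / ((2 * R : ℕ) : ℝ))) *
                (star (localPair dWaveFormFactor L x *ᵥ ψ) ⬝ᵥ (localPair dWaveFormFactor L y *ᵥ ψ)).re) := by
  sorry

/-! ### The crux (and the summit), by name, from the four stubs -/

/-- **The line closes the crux modulo its four stubs**: `MesoscopicPairOrder` from (GS), (Flat), (Q), (D)
through the landed pointwise glue `meso_and_summit_of_boxStubs` (p151069: at (D)'s witness point
(GS) ∧ (Flat) ⇒ profile, (Q) ∧ (D) ⇒ super-linear ⇒ seed ⇒ uniform sector pair order ⇒ crux). [folklore] -/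
theorem MesoscopicPairOrder_of : MesoscopicPairOrder :=
  (meso_and_summit_of_boxStubs stub_pairGoldstoneShapeOnBox stub_offWindowFlatOnBox
    stub_pairFluctuationFloor stub_coherenceDoubling).1

/-- **The same four stubs close the SUMMIT** `HubbardSuperconductivity` (uniform sector pair order at
(D)'s witness is `d`-wave pair LRO in every sector ground state there). [folklore] -/
theorem HubbardSuperconductivity_of : _root_.HubbardSuperconductivity :=
  (meso_and_summit_of_boxStubs stub_pairGoldstoneShapeOnBox stub_offWindowFlatOnBox
    stub_pairFluctuationFloor stub_coherenceDoubling).2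

end Summit.HubbardSuperconductivity.HubbardSuperconductivity.Cruxes.MesoscopicPairOrder.RedirectBirth
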